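import Literature.NumberTheory.LFunctions.Zhang2022.MainTermFormCauchySchwarz
import Literature.NumberTheory.LFunctions.Zhang2022.MainTermFormH1Kernel

/-!
# The equality case of Cauchy–Schwarz for `𝔅` on `H¹` profiles: the margin-zero locus

Companion to `MainTermFormCauchySchwarz` and `MainTermFormH1Kernel` (repair cell `pub-zhang`,
audit + repair census of Y. Zhang, *Discrete mean estimates and the Landau–Siegel zero*,
arXiv:2211.02515 (2022) [Zhang2022LandauSiegel]; the cell's verdict on that manuscript is NEGATIVE —
the printed inequality (8.24) fails, `Zhang2022.not_ineq824` — and this file makes no claim about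
its Theorems 1–2 and no claim about Landau–Siegel zeros).

`MainTermFormCauchySchwarz.norm_sq_mainTermFormPolar_le` proves `|P(u,f)|² ≤ 𝔅(u,u)·𝔅(f,f)` for
the polar form `P` of the glued main-term form `𝔅` (`mainTermForm`, STRUCTURE.md (4.1) of the cell)
on `H¹` profiles, whence `not_closing_of_isH1`: the closing shape `√(q·c_J) < d` of §2
(`Section2Assembly.EndgameData.false_of_closing`, `Section2MainOrder.MainOrderContradiction`) is
unattainable by main-order constants of polar provenance. `MainTermFormH1Kernel` identifies the
null space of `𝔅` on `H¹`: `𝔅(g,g) = 0 ↔ g ∈ AFE := span{e^{−iπy}, e^{−2iπy}, e^{−3iπy}}` on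
`[0,1]` (`mainTermForm_eq_zero_iff_afeSpan_of_isH1`). This file combines the two into the
EQUALITY CASE, i.e. it locates exactly where the main-order margin of the cell's ALT seat 2
(`b2b-zhang-alt-2/ALT-2.md`: alternative mollifier lengths / smoothings / extra pieces) vanishes:

* `mainTermFormPolar_add_smul_right` — `P(u, f + t u) = P(u,f) + conj t · 𝔅(u,u)`;
  `mainTermForm_sub_proj` — the projection identity
  `𝔅(f − s u) = 𝔅(f,f) − |P(u,f)|²/𝔅(u,u)`, `s = conj P(u,f)/𝔅(u,u)` (`𝔅(u,u) ≠ 0`).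
* `norm_sq_mainTermFormPolar_eq_mul_of_add_smul` — if `𝔅(f + t u) = 0` for some `t` then
  `|P(u,f)|² = 𝔅(u,u)𝔅(f,f)` (no positivity needed);
  `norm_sq_mainTermFormPolar_eq_mul_iff` — for `𝔅(u,u) > 0` the converse:
  **`|P(u,f)|² = 𝔅(u,u)𝔅(f,f) ↔ ∃ t, 𝔅(f + t u) = 0`**.
* `norm_sq_mainTermFormPolar_eq_mul_iff_eqOn` — with the kernel theorem:
  **`|P(u,f)|² = 𝔅(u,u)𝔅(f,f) ↔ ∃ t a b c, f = t·u + a e^{−iπy} + b e^{−2iπy} + c e^{−3iπy}`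
  on `[0,1]`** (`𝔅(u,u) > 0`); `norm_sq_mainTermFormPolar_lt_mul` — STRICT Cauchy–Schwarz off
  that locus; `norm_mainTermFormPolar_eq_sqrt_of_eqOn` — `|P(u,f)| = √(𝔅(u,u)𝔅(f,f))` on it
  (in particular `norm_mainTermFormPolar_self_eq`: a `J`-profile that IS the direction);
  `mainTermFormPolar_margin_dichotomy` packages the two cases.
* `lt_sqrt_of_mainTerm_thresholds_of_not_eqOn` — the §2 shape: if `𝔅(𝔤,𝔤) ≤ q`, `𝔅(f,f) ≤ c_J`,
  `d ≤ |P(𝔤,f)|`, `𝔅(𝔤,𝔤) > 0` and `f ∉ ℂ𝔤 + AFE`, then `d < √(q·c_J)` STRICTLY.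

Census reading (cell rows V18 / V12 (a); ALT-2 gen 2 certificate `alt2_cert_B.json`, kit job
j055008): in the cell's dictionary (`b2b-zhang-lead/g2/STRUCTURE.md` §§0, 4, 6) a design is a pair
(`𝔤` = a direction in the span `V` of the glued `H`-pieces, `f` = the `J`-profile) and its main-order
constants are `C₂₃₂ = 𝔅(𝔤,𝔤)`, `C₂₃₃ = 𝔅(f,f)`, `𝔡′+𝔡 = P(𝔤,f)`. For a single direction `𝔤` with
`𝔅(𝔤,𝔤) > 0` this file proves: the margin `√(C₂₃₂C₂₃₃) − |𝔡′+𝔡|` is `> 0` unless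
`f ∈ ℂ𝔤 + AFE` on `[0,1]`, where it is exactly `0`. A strictly positive main-order margin cannot be
overturned by the manuscript's lower-order terms (all `o(𝔞𝔓)` relative to the main terms), so the
only designs of the admissible class on which those (uncomputed) lower-order terms could matter are
the ones with `f ∈ V + AFE` — by elementary finite-dimensional linear algebra on `(V + ℂf)/AFE` the
design optimum `T_opt(d) = sup_{𝔤 ∈ V} |P(𝔤,f)|²/𝔅(𝔤,𝔤)` equals `C_J(d) = 𝔅(f,f)` iff
`f ∈ V + AFE` (not formalised here; the certificate's two singular bordered Grams, designs R07/R08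
with `f ∈ V`, are instances of `norm_sq_mainTermFormPolar_eq_mul_of_add_smul`). That is precisely
the content of census cell V12 (a), which lies OUTSIDE the manuscript (no lower-order term is
computed there). All declarations are elementary and tagged `[folklore]`.
-/

noncomputable section

open MeasureTheory Set intervalIntegral
open scoped Real ComplexConjugate

namespace Literature.NumberTheory.LFunctions.Zhang2022

variable {u u' f f' g g' : ℝ → ℂ}

/-! ### The polar form along the line `f + t u` -/

/-- `P(u, f + t u) = P(u,f) + conj t · 𝔅(u,u)` for `H¹` profiles. [folklore] -/
theorem mainTermFormPolar_add_smul_right (hu : IsH1OnUnitInterval u u')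
    (hf : IsH1OnUnitInterval f f') (t : ℂ) :
    mainTermFormPolar u u' (fun x => f x + t * u x) (fun x => f' x + t * u' x)
      = mainTermFormPolar u u' f f' + conj t * (mainTermForm u u' : ℂ) := by
  have h1 := mainTermFormSesq_add_smul_right hu hf hu t
  have h2 := mainTermFormSesq_add_smul_left hf hu hu t
  rw [← mainTermFormPolar_self]
  simp only [mainTermFormPolar, h1, h2, map_add, map_mul]
  ring

/-- **Projection identity.** For `H¹` profiles with `𝔅(u,u) ≠ 0`, subtracting from `f` its
`𝔅`-projection on `u` (coefficient `s = conj P(u,f) / 𝔅(u,u)`) leaves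
`𝔅(f − s u) = 𝔅(f,f) − |P(u,f)|² / 𝔅(u,u)`. [folklore] -/
theorem mainTermForm_sub_proj (hu : IsH1OnUnitInterval u u') (hf : IsH1OnUnitInterval f f')
    (h0 : mainTermForm u u' ≠ 0) :
    mainTermForm
        (fun x => f x + (-(conj (mainTermFormPolar u u' f f') / (mainTermForm u u' : ℂ))) * u x)
        (fun x => f' x + (-(conj (mainTermFormPolar u u' f f') / (mainTermForm u u' : ℂ))) * u' x)
      = mainTermForm f f' - ‖mainTermFormPolar u u' f f'‖ ^ 2 / mainTermForm u u' := by
  set P := mainTermFormPolar u u' f f' with hPdef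
  set B := mainTermForm u u' with hBdef
  rw [mainTermForm_add_smul hf hu, mainTermFormPolar_swap u u' f f', ← hPdef]
  have ht : conj (-(conj P / (B : ℂ))) = -(P / (B : ℂ)) := by
    rw [map_neg, map_div₀, Complex.conj_conj, Complex.conj_ofReal]
  have hre : (conj (-(conj P / (B : ℂ))) * conj P).re = -(‖P‖ ^ 2 / B) := by
    rw [ht, neg_mul, Complex.neg_re, div_mul_eq_mul_div, Complex.mul_conj', ← Complex.ofReal_pow,
      ← Complex.ofReal_div, Complex.ofReal_re]
  have hnorm : ‖-(conj P / (B : ℂ))‖ ^ 2 = ‖P‖ ^ 2 / B ^ 2 := by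
    rw [norm_neg, norm_div, RCLike.norm_conj, Complex.norm_real, Real.norm_eq_abs, div_pow, sq_abs]
  rw [hre, hnorm]
  field_simp
  ring

/-- If some `f + t u` lies in the null space of `𝔅` then Cauchy–Schwarz for `(u, f)` is an
EQUALITY (no positivity hypothesis needed): `P(u,f) = −conj t · 𝔅(u,u)` and
`𝔅(f,f) = |t|² 𝔅(u,u)`. [folklore] -/
theorem norm_sq_mainTermFormPolar_eq_mul_of_add_smul (hu : IsH1OnUnitInterval u u')
    (hf : IsH1OnUnitInterval f f') (t : ℂ)
    (ht : mainTermForm (fun x => f x + t * u x) (fun x => f' x + t * u' x) = 0) :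
    ‖mainTermFormPolar u u' f f'‖ ^ 2 = mainTermForm u u' * mainTermForm f f' := by
  have hBu := mainTermForm_nonneg_of_isH1 hu
  have hft := hf.add_smul hu t
  -- `P(u, f + t u) = 0`: Cauchy–Schwarz against a null profile
  have hP0 : mainTermFormPolar u u' (fun x => f x + t * u x) (fun x => f' x + t * u' x) = 0 := by
    have h := norm_sq_mainTermFormPolar_le hu hft
    rw [ht, mul_zero] at h
    have h' : ‖mainTermFormPolar u u' (fun x => f x + t * u x) (fun x => f' x + t * u' x)‖ ^ 2 = 0 :=
      le_antisymm h (sq_nonneg _)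
    exact norm_eq_zero.1 (pow_eq_zero_iff two_ne_zero |>.1 h')
  -- hence `P(u,f) = −conj t · 𝔅(u,u)`
  have hP : mainTermFormPolar u u' f f' = -(conj t * (mainTermForm u u' : ℂ)) := by
    rw [mainTermFormPolar_add_smul_right hu hf t] at hP0
    linear_combination hP0
  -- and `𝔅(f,f) = |t|² 𝔅(u,u)` from the polarisation identity for `𝔅(f + t u) = 0`
  have hF : mainTermForm f f' = ‖t‖ ^ 2 * mainTermForm u u' := by
    have h := ht
    rw [mainTermForm_add_smul hf hu t, mainTermFormPolar_swap u u' f f', hP] at h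
    have hre : (conj t * conj (-(conj t * (mainTermForm u u' : ℂ)))).re
        = -(‖t‖ ^ 2 * mainTermForm u u') := by
      rw [map_neg, map_mul, Complex.conj_conj, Complex.conj_ofReal, mul_neg, ← mul_assoc,
        Complex.conj_mul', Complex.neg_re, ← Complex.ofReal_pow, ← Complex.ofReal_mul,
        Complex.ofReal_re]
    rw [hre] at h
    linarith
  rw [hP, hF, norm_neg, norm_mul, RCLike.norm_conj, Complex.norm_real, Real.norm_of_nonneg hBu]
  ring

/-! ### The equality case -/

/-- **Equality in Cauchy–Schwarz, profile form.** For `H¹` profiles `u, f` with `𝔅(u,u) > 0`: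
`|P(u,f)|² = 𝔅(u,u)·𝔅(f,f)` iff `𝔅(f + t u) = 0` for some `t ∈ ℂ`. [folklore] -/
theorem norm_sq_mainTermFormPolar_eq_mul_iff (hu : IsH1OnUnitInterval u u')
    (hf : IsH1OnUnitInterval f f') (hpos : 0 < mainTermForm u u') :
    ‖mainTermFormPolar u u' f f'‖ ^ 2 = mainTermForm u u' * mainTermForm f f' ↔
      ∃ t : ℂ, mainTermForm (fun x => f x + t * u x) (fun x => f' x + t * u' x) = 0 := by
  constructor
  · intro heq
    refine ⟨-(conj (mainTermFormPolar u u' f f') / (mainTermForm u u' : ℂ)), ?_⟩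
    rw [mainTermForm_sub_proj hu hf hpos.ne', heq, mul_div_cancel_left₀ _ hpos.ne', sub_self]
  · rintro ⟨t, ht⟩
    exact norm_sq_mainTermFormPolar_eq_mul_of_add_smul hu hf t ht

/-- **Equality in Cauchy–Schwarz = the `J`-profile is the direction plus an AFE combination.**
For `H¹` profiles `u, f` with `𝔅(u,u) > 0`: `|P(u,f)|² = 𝔅(u,u)·𝔅(f,f)` iff
`f = t·u + a·e^{−iπy} + b·e^{−2iπy} + c·e^{−3iπy}` on `[0,1]` for some `t a b c ∈ ℂ`
(`MainTermFormH1Kernel.mainTermForm_eq_zero_iff_afeSpan_of_isH1`). [folklore] -/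
theorem norm_sq_mainTermFormPolar_eq_mul_iff_eqOn (hu : IsH1OnUnitInterval u u')
    (hf : IsH1OnUnitInterval f f') (hpos : 0 < mainTermForm u u') :
    ‖mainTermFormPolar u u' f f'‖ ^ 2 = mainTermForm u u' * mainTermForm f f' ↔
      ∃ t a b c : ℂ, EqOn f
        (fun y => t * u y + a * afeDir 1 y + b * afeDir 2 y + c * afeDir 3 y) (Icc 0 1) := by
  rw [norm_sq_mainTermFormPolar_eq_mul_iff hu hf hpos]
  constructor
  · rintro ⟨t, ht⟩
    obtain ⟨a, b, c, h⟩ := (mainTermForm_eq_zero_iff_afeSpan_of_isH1 (hf.add_smul hu t)).mp ht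
    refine ⟨-t, a, b, c, fun y hy => ?_⟩
    have := h hy
    simp only at this ⊢
    linear_combination this
  · rintro ⟨t, a, b, c, h⟩
    refine ⟨-t, (mainTermForm_eq_zero_iff_afeSpan_of_isH1 (hf.add_smul hu (-t))).mpr
      ⟨a, b, c, fun y hy => ?_⟩⟩
    have := h hy
    simp only at this ⊢
    linear_combination this

/-- **Strict Cauchy–Schwarz off the locus**: if `f` is NOT of the form `t·u + AFE` on `[0,1]`
then `|P(u,f)|² < 𝔅(u,u)·𝔅(f,f)` (`𝔅(u,u) > 0`). [folklore] -/
theorem norm_sq_mainTermFormPolar_lt_mul (hu : IsH1OnUnitInterval u u')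
    (hf : IsH1OnUnitInterval f f') (hpos : 0 < mainTermForm u u')
    (h : ¬ ∃ t a b c : ℂ, EqOn f
        (fun y => t * u y + a * afeDir 1 y + b * afeDir 2 y + c * afeDir 3 y) (Icc 0 1)) :
    ‖mainTermFormPolar u u' f f'‖ ^ 2 < mainTermForm u u' * mainTermForm f f' :=
  lt_of_le_of_ne (norm_sq_mainTermFormPolar_le hu hf)
    (fun heq => h ((norm_sq_mainTermFormPolar_eq_mul_iff_eqOn hu hf hpos).mp heq))

/-- **On the locus the margin is exactly zero**: if `f = t·u + AFE` on `[0,1]` then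
`|P(u,f)| = √(𝔅(u,u)·𝔅(f,f))` (no positivity hypothesis). [folklore] -/
theorem norm_mainTermFormPolar_eq_sqrt_of_eqOn (hu : IsH1OnUnitInterval u u')
    (hf : IsH1OnUnitInterval f f') {t a b c : ℂ} (h : EqOn f
        (fun y => t * u y + a * afeDir 1 y + b * afeDir 2 y + c * afeDir 3 y) (Icc 0 1)) :
    ‖mainTermFormPolar u u' f f'‖ = Real.sqrt (mainTermForm u u' * mainTermForm f f') := by
  have h0 : mainTermForm (fun x => f x + (-t) * u x) (fun x => f' x + (-t) * u' x) = 0 :=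
    (mainTermForm_eq_zero_iff_afeSpan_of_isH1 (hf.add_smul hu (-t))).mpr
      ⟨a, b, c, fun y hy => by have := h hy; simp only at this ⊢; linear_combination this⟩
  rw [← norm_sq_mainTermFormPolar_eq_mul_of_add_smul hu hf (-t) h0, Real.sqrt_sq (norm_nonneg _)]

/-- In particular a `J`-profile that IS the direction (`f = u`: the cell's designs R07/R08, whose
bordered Gram matrices are singular) sits on the locus: `|P(f,f)| = 𝔅(f,f) = √(𝔅(f,f)·𝔅(f,f))`.
[folklore] -/
theorem norm_mainTermFormPolar_self_eq (hf : IsH1OnUnitInterval f f') :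
    ‖mainTermFormPolar f f' f f'‖ = Real.sqrt (mainTermForm f f' * mainTermForm f f') :=
  norm_mainTermFormPolar_eq_sqrt_of_eqOn hf hf (t := 1) (a := 0) (b := 0) (c := 0)
    (fun y _ => by simp)

/-! ### The shape consumed by §2: strict failure off the locus -/

/-- **Off the locus the §2 closing fails STRICTLY.** If `𝔅(𝔤,𝔤) ≤ q`, `𝔅(f,f) ≤ c_J`,
`d ≤ |P(𝔤,f)|`, `𝔅(𝔤,𝔤) > 0` and `f ∉ ℂ𝔤 + AFE` on `[0,1]`, then `d < √(q·c_J)`: the closing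
condition `√(q·c_J) < d` misses by a POSITIVE main-order margin, which no lower-order term can
repair. (On the locus it misses by exactly `0` at main order —
`norm_mainTermFormPolar_eq_sqrt_of_eqOn` — and only there do the manuscript's uncomputed
lower-order terms decide: census cell V12 (a).) [folklore] -/
theorem lt_sqrt_of_mainTerm_thresholds_of_not_eqOn (hg : IsH1OnUnitInterval g g')
    (hf : IsH1OnUnitInterval f f') (hpos : 0 < mainTermForm g g')
    (hnot : ¬ ∃ t a b c : ℂ, EqOn f
        (fun y => t * g y + a * afeDir 1 y + b * afeDir 2 y + c * afeDir 3 y) (Icc 0 1))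
    {q cJ d : ℝ} (hq : mainTermForm g g' ≤ q) (hcJ : mainTermForm f f' ≤ cJ)
    (hd : d ≤ ‖mainTermFormPolar g g' f f'‖) : d < Real.sqrt (q * cJ) := by
  have hlt : ‖mainTermFormPolar g g' f f'‖ < Real.sqrt (mainTermForm g g' * mainTermForm f f') :=
    (Real.lt_sqrt (norm_nonneg _)).mpr (norm_sq_mainTermFormPolar_lt_mul hg hf hpos hnot)
  refine hd.trans_lt (hlt.trans_le (Real.sqrt_le_sqrt ?_))
  exact mul_le_mul hq hcJ (mainTermForm_nonneg_of_isH1 hf)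
    ((mainTermForm_nonneg_of_isH1 hg).trans hq)

/-- Dichotomy packaging for the census (row V18 / cell V12 (a)): for `H¹` profiles with
`𝔅(𝔤,𝔤) > 0`, EITHER `f ∈ ℂ𝔤 + AFE` on `[0,1]` and `|P(𝔤,f)| = √(𝔅(𝔤,𝔤)𝔅(f,f))` (margin `0`),
OR `|P(𝔤,f)| < √(𝔅(𝔤,𝔤)𝔅(f,f))` (strict). [folklore] -/
theorem mainTermFormPolar_margin_dichotomy (hg : IsH1OnUnitInterval g g')
    (hf : IsH1OnUnitInterval f f') (hpos : 0 < mainTermForm g g') :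
    ((∃ t a b c : ℂ, EqOn f
        (fun y => t * g y + a * afeDir 1 y + b * afeDir 2 y + c * afeDir 3 y) (Icc 0 1)) ∧
      ‖mainTermFormPolar g g' f f'‖ = Real.sqrt (mainTermForm g g' * mainTermForm f f')) ∨
    ‖mainTermFormPolar g g' f f'‖ < Real.sqrt (mainTermForm g g' * mainTermForm f f') := by
  by_cases h : ∃ t a b c : ℂ, EqOn f
      (fun y => t * g y + a * afeDir 1 y + b * afeDir 2 y + c * afeDir 3 y) (Icc 0 1)
  · obtain ⟨t, a, b, c, he⟩ := h
    exact Or.inl ⟨⟨t, a, b, c, he⟩, norm_mainTermFormPolar_eq_sqrt_of_eqOn hg hf he⟩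
  · exact Or.inr ((Real.lt_sqrt (norm_nonneg _)).mpr (norm_sq_mainTermFormPolar_lt_mul hg hf hpos h))

end Literature.NumberTheory.LFunctions.Zhang2022
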